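import Summits.QuantumFields.BalabanUV.T4Continuum.Support.NE7EnergyRateWPrep
import HarnessLib

/-!
# NE7EnergyRateWPrepGeneric — PORT MAP P3.5 (part 1∕2): gen 105's `NE7EnergyRateWPrep` AT BLOCK SIZE `L` — the lower bound `wallConst·dualC2·√g·N²∕(L·M) ≤ residualScale`
# (`M = L^{j+1}`), `dualC2 4 L > 0`, and the admissibility of the block average `cavg L U_B` of a regular finer minimiser as a competitor of the coarser problem under the
# COMPETITOR LINE `b + 226·320²·L²·b² ≤ ε` (`= b + c(L)·b²`, `c(2) = 92 569 600 ≤ 10⁸` — gen 105's line), with the class level family and the [B7] Prop. 1 cap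
# `512·5·8·L²·ε ≤ 1` DISPLAYED (at `L = 2` these are `levelSmall_all_d4_L2` and `ε ≤ 10⁻¹¹`)

Cell `pub-balaban`, rung (B)+1 sub-cell t4, lineage `b2b-balaban-t4-ne7b-p1` (row NE7b OWNER + CRUX PROVER), generation 156 — INTERFACE REQUEST NE7→NE7b PORT P3.5 of the road
t4-ne7-p1 g109 ([NE7P1-G109-INBOX-2], memo `t4/b2b-balaban-t4-ne7-p1-g109/ROAD-G109.md` §3 «PORT MAP», recipe `2 ↦ L`): «re-issue gen 105's `NE7EnergyRateWPrep` (`residualScale_lower_d4`,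
`cavg_admissible_d4` with the competitor line `b + c(L)·b² ≤ ε` in place of `b + 10⁸b²`, `dualC2 4 L > 0`; `kfree_coercivity` is already `kfree_coercivity_card`)».  Part 2
(`NE7EnergyRateWGenericL`) re-issues the assembly `ne3EnergyRateWSup_of_classPoincare` at block size `L`.
WHAT ([folklore]; 0 def, 0 sorry; proofs = gen 105's verbatim under the recipe).  §1 `dualC2_pos` (`L ≥ 1`), **`residualScale_lower`** (`wallConst 4 L·dualC2 4 L·√g·N²∕(L·L^{j+1}) ≤
residualScale 4 L N b g (j+1)`); §2 **`cavg_admissible`** (`2 ≤ L`, `0 < ε`, `512·5·8·L²·ε ≤ 1`, the level family `∀ k, LevelSmall 4 L k (ε∕(L^{k+1})²)`, `0 ≤ b`,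
`b + 226·320²·L²·b² ≤ ε`: for a level-`(j+2)` minimiser `U_B` of `sfClass 4 L N ε` over `V` with `Regular 4 L N b g (j+2) U_B`, the block average `cavg L U_B` is unitary,
`(N·L^{j+1})`-periodic, `SmallField (ε∕(L^{j+1})²)` and admissible at level `j+1` over `V`; with `b < ε` and the two level-family instances the assembly reads).  The pure real
lemmas of gen 105's §1∕§3∕§3b (`le_add_sqrt_of_sq_le`, `wallConst_pos`, `kfree_coercivity`(→ `_card`), `spike_coef_le`, `spike_energy_le`, `two_sided_ineq`, `rate_algebra`,
`ratio_le_of_lower`) are block-size-free and are imported, not restated (part 2 reads `ratio_le_of_lower`∕`rate_algebra` at the weight `w₀ = 2·wallConst·dualC2·√g∕L`).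
HONEST FRAMING (page 1): bookkeeping over landed kernel theorems; nothing of Bałaban's asserted; NOT T-E_w♯ (part 2), NOT NE3, NOT NE7; row NE7b (`T4WeightBudget.RelWeightBound`) NOT
PRINTED ∕ NOT PROVED; spine count = dagwriter's call; finite T⁴ rung (B)+1 — NOT infinite volume, NOT mass gap, NOT BetaPertH, NOT Clay (continuum YM on T⁴ ⇐ BetaPertH ∧ nine spine
estimates).
-/

set_option autoImplicit false

open scoped BigOperators Matrix Matrix.Norms.L2Operator
open NormedSpace Finset Set

namespace Summit.QuantumFields.BalabanUV.T4Continuum.NE7EnergyRateWPrepGeneric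

open Literature.MathematicalPhysics.QuantumFieldTheory.Balaban1983to89
open B7Prop1Explicit B7Prop2Explicit
open T4AveragingDeficitWall (IsUnitaryCfg IsSkewDir SmallField)
open T4AveragingDeficitWallBoundary (IsPeriodicCfg periodBox)
open AveragingDeficitDerivWallProof (wallConst wallConst_nonneg)
open AveragingDeficitDualResidual (dualC2 dualC1)
open AveragingDeficitChartCalculus (cavg)
open AveragingDeficitTwoLevelPrep (prop1Radius smallField_cavg)
open AveragingDeficitFermat (isPeriodicCfg_cavg)
open AveragingDeficitMultiLevelPrep (LevelSmall)
open AveragingDeficitMultiLevelBridge (cavg_eq_rescale_bavg)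
open MinimalActionLevels (avgIter_rescale_bavg)
open MinimalActionSandwich (IsMinimiser admissible)
open MinimalActionRate (sfClass Regular)
open NE3EnergyShapes (residualScale dualC1_nonneg dualC2_nonneg)
open NE3EnergyChartLeaves (isUnitaryCfg_cavg_of_regular)

noncomputable section

/-! ## §1 Positivity and the lower bound of the residual scale at block size `L` -/

/-- `dualC2 4 L > 0` for `L ≥ 1` (there is a plane in four dimensions). [folklore] -/
theorem dualC2_pos {L : ℕ} (hL : 1 ≤ L) : 0 < dualC2 4 L := by
  unfold dualC2
  have hL0 : (0 : ℝ) < L := by exact_mod_cast hL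
  have hP : 0 < Fintype.card (T4AveragingDeficitWall.Plane 4) :=
    Fintype.card_pos_iff.mpr ⟨⟨((0 : Fin 4), (1 : Fin 4)), by decide⟩⟩
  have hP' : (0 : ℝ) < Fintype.card (T4AveragingDeficitWall.Plane 4) := by exact_mod_cast hP
  have hs : 0 < Real.sqrt (8 * Fintype.card (T4AveragingDeficitWall.Plane 4)) := Real.sqrt_pos.2 (by positivity)
  positivity

/-- **THE RESIDUAL SCALE DOMINATES ITS FLUX-GRADIENT TERM AT BLOCK SIZE `L`** (`d = 4`, level `j+1`, `M := L^{j+1}`, `L ≥ 1`, `g ≥ 0`):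
`wallConst 4 L·dualC2 4 L·√g·N²∕(L·M) ≤ residualScale 4 L N b g (j+1)`. [folklore] -/
theorem residualScale_lower {L : ℕ} (hL : 1 ≤ L) (N j : ℕ) {b g : ℝ} (hg : 0 ≤ g) :
    wallConst 4 L * dualC2 4 L * Real.sqrt g * (N : ℝ) ^ 2 / ((L : ℝ) * (L : ℝ) ^ (j + 1)) ≤ residualScale 4 L N b g (j + 1) := by
  unfold residualScale
  have hL0 : (0 : ℝ) < L := by exact_mod_cast hL
  have hM0 : (0 : ℝ) < (L : ℝ) ^ (j + 1 + 1) := by positivity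
  have hw := wallConst_nonneg 4 L
  have hd2 := dualC2_nonneg 4 L
  have hd1 := dualC1_nonneg 4 L
  have hz : (L : ℝ) ^ (4 - ((4 : ℕ) : ℤ)) = 1 := by norm_num
  rw [hz, one_mul]
  -- the flux-gradient term: `√(g N⁴ M′⁴/M′⁶) = √g·N²/M′`, `M′ = L·M`
  have hid : g * (N : ℝ) ^ 4 * ((L : ℝ) ^ (j + 1 + 1)) ^ 4 / ((L : ℝ) ^ (j + 1 + 1)) ^ 6
      = (Real.sqrt g * (N : ℝ) ^ 2 / (L : ℝ) ^ (j + 1 + 1)) ^ 2 := by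
    rw [div_pow, mul_pow, Real.sq_sqrt hg]; field_simp
  have hsq : Real.sqrt (g * (N : ℝ) ^ 4 * ((L : ℝ) ^ (j + 1 + 1)) ^ 4 / ((L : ℝ) ^ (j + 1 + 1)) ^ 6)
      = Real.sqrt g * (N : ℝ) ^ 2 / (L : ℝ) ^ (j + 1 + 1) := by
    rw [hid, Real.sqrt_sq (by positivity)]
  rw [hsq]
  have hM' : (L : ℝ) ^ (j + 1 + 1) = (L : ℝ) * (L : ℝ) ^ (j + 1) := by rw [pow_succ]; ring
  rw [hM']
  have h2 : 0 ≤ (b / ((L : ℝ) * (L : ℝ) ^ (j + 1)) ^ 2) ^ 2 * dualC1 4 L * Real.sqrt ((((4 : ℕ) : ℝ)) * ((N * L ^ (j + 1) : ℕ) : ℝ) ^ 4) := by positivity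
  have h3 : wallConst 4 L * dualC2 4 L * Real.sqrt g * (N : ℝ) ^ 2 / ((L : ℝ) * (L : ℝ) ^ (j + 1))
      = wallConst 4 L * (Real.sqrt g * (N : ℝ) ^ 2 / ((L : ℝ) * (L : ℝ) ^ (j + 1)) * dualC2 4 L) := by ring
  rw [h3]
  exact mul_le_mul_of_nonneg_left (le_add_of_nonneg_right h2) hw

/-! ## §2 The block average of a regular finer minimiser is an admissible competitor (block size `L`) -/

/-- **`cavg L U_B` IS ADMISSIBLE** (`d = 4`, `2 ≤ L`, `0 < ε` with the [B7] Prop. 1 cap `512·5·8·L²·ε ≤ 1` and the class level family, `0 ≤ b`, the competitor line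
`b + 226·320²·L²·b² ≤ ε`): for a level-`(j+2)` minimiser `U_B` of `sfClass 4 L N ε` with datum `V` and `Regular 4 L N b g (j+2) U_B`, the block average `W := cavg L U_B` is
unitary, `(N·L^{j+1})`-periodic, `SmallField W (ε∕(L^{j+1})²)` and admissible at level `j+1` over `V`; exported together with `b < ε` and the two level-family instances the
assembly reads. [folklore] -/
theorem cavg_admissible {n : Type} [Fintype n] [DecidableEq n] [Nonempty n] {L : ℕ} (hL : 2 ≤ L) {N : ℕ} [NeZero N] (j : ℕ) {ε b g : ℝ}
    (hε : 0 < ε) (hcap : 512 * (((4 : ℕ) : ℝ) + 1) * (((4 : ℕ) : ℝ) + 4) * (L : ℝ) ^ 2 * ε ≤ 1)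
    (hls : ∀ k : ℕ, LevelSmall 4 L k (ε / ((L : ℝ) ^ (k + 1)) ^ 2))
    (hb : 0 ≤ b) (hbq : b + 226 * 320 ^ 2 * (L : ℝ) ^ 2 * b ^ 2 ≤ ε)
    {V UB : Site 4 → Fin 4 → (Matrix n n ℂ)ˣ} (hB : IsMinimiser 4 (sfClass 4 L N ε) L N (j + 2) V UB) (hreg : Regular 4 L N b g (j + 2) UB) :
    b < ε ∧ LevelSmall 4 L j (ε / ((L : ℝ) ^ (j + 1)) ^ 2) ∧ LevelSmall 4 L (j + 1) (ε / ((L : ℝ) ^ (j + 2)) ^ 2) ∧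
    IsUnitaryCfg (cavg L UB) ∧ IsPeriodicCfg (cavg L UB) ((N * L ^ (j + 1) : ℕ) : ℤ) ∧
    SmallField (cavg L UB) (ε / ((L : ℝ) ^ (j + 1)) ^ 2) ∧
    cavg L UB ∈ admissible (sfClass 4 L N ε) L (j + 1) V := by
  have hL1 : 1 ≤ L := Nat.le_trans (by norm_num) hL
  have hL0 : (0 : ℝ) < L := by exact_mod_cast hL1
  have hLr1 : (1 : ℝ) ≤ L := by exact_mod_cast hL1
  have hbε : b < ε := by
    rcases hb.eq_or_lt with h0 | hpos
    · rw [← h0]; exact hε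
    · have : 0 < 226 * 320 ^ 2 * (L : ℝ) ^ 2 * b ^ 2 := by positivity
      linarith
  have hs1 : LevelSmall 4 L j (ε / ((L : ℝ) ^ (j + 1)) ^ 2) := hls j
  have hs2 : LevelSmall 4 L (j + 1) (ε / ((L : ℝ) ^ (j + 2)) ^ 2) := hls (j + 1)
  have hWu : IsUnitaryCfg (cavg L UB) := isUnitaryCfg_cavg_of_regular hL1 j hb hbε hs2 hreg
  -- periodicity: `U_B` is `(N·L^{j+2}) = L·(N·L^{j+1})`-periodic
  have hper : IsPeriodicCfg UB ((L : ℤ) * ((N * L ^ (j + 1) : ℕ) : ℤ)) := by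
    have e : ((L : ℤ) * ((N * L ^ (j + 1) : ℕ) : ℤ)) = ((N * L ^ (j + 2) : ℕ) : ℤ) := by push_cast; ring
    rw [e]; exact hreg.periodic
  have hWP : IsPeriodicCfg (cavg L UB) ((N * L ^ (j + 1) : ℕ) : ℤ) := isPeriodicCfg_cavg L (N * L ^ (j + 1)) (by exact_mod_cast hper)
  -- the small-field radius: `prop1Radius 4 L (b/(L^{j+2})²) ≤ ε/(L^{j+1})²`
  have hP0 : (0 : ℝ) < ((L : ℝ) ^ (j + 2)) ^ 2 := by positivity
  have hP1 : (1 : ℝ) ≤ ((L : ℝ) ^ (j + 2)) ^ 2 := one_le_pow₀ (one_le_pow₀ hLr1)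
  have ha : 0 ≤ b / ((L : ℝ) ^ (j + 2)) ^ 2 := div_nonneg hb hP0.le
  have h512 : 512 * (4 + 1) * (4 + 4) * (L : ℝ) ^ 2 * (b / ((L : ℝ) ^ (j + 2)) ^ 2) ≤ 1 := by
    have h1 : b / ((L : ℝ) ^ (j + 2)) ^ 2 ≤ b := div_le_self hb hP1
    have h2 : 512 * (4 + 1) * (4 + 4) * (L : ℝ) ^ 2 * (b / ((L : ℝ) ^ (j + 2)) ^ 2) ≤ 512 * (4 + 1) * (4 + 4) * (L : ℝ) ^ 2 * ε :=
      mul_le_mul_of_nonneg_left (h1.trans hbε.le) (by positivity)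
    push_cast at hcap
    linarith
  have hsm := smallField_cavg (d := 4) hL1 hreg.unitary ha (by push_cast at h512 ⊢; exact h512) hreg.small
  have hrad : prop1Radius 4 L (b / ((L : ℝ) ^ (j + 2)) ^ 2) ≤ ε / ((L : ℝ) ^ (j + 1)) ^ 2 := by
    unfold prop1Radius
    have e1 : ((L : ℝ) ^ (j + 2)) ^ 2 = (L : ℝ) ^ 2 * ((L : ℝ) ^ (j + 1)) ^ 2 := by rw [pow_succ]; ring
    set P : ℝ := ((L : ℝ) ^ (j + 2)) ^ 2 with hPdef
    have hL2 : (0 : ℝ) < (L : ℝ) ^ 2 := by positivity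
    have hQ : ((L : ℝ) ^ (j + 1)) ^ 2 = P / (L : ℝ) ^ 2 := by rw [e1]; field_simp
    rw [hQ]
    have hb2 : (b / P) ^ 2 ≤ b ^ 2 / P := by
      rw [div_pow]
      exact div_le_div_of_nonneg_left (sq_nonneg b) hP0 (by nlinarith)
    -- the honest inequality: `L²(b/P) + 226(8·5·8·L²·(b/P))² ≤ L²ε/P`
    have e2 : ε / (P / (L : ℝ) ^ 2) = (L : ℝ) ^ 2 * ε / P := by field_simp
    rw [e2]
    have e3 : (L : ℝ) ^ 2 * (b / P) + 226 * (8 * (((4 : ℕ) : ℝ) + 1) * (((4 : ℕ) : ℝ) + 4) * (L : ℝ) ^ 2 * (b / P)) ^ 2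
        = (L : ℝ) ^ 2 * (b / P) + 226 * 320 ^ 2 * (L : ℝ) ^ 4 * (b / P) ^ 2 := by push_cast; ring
    rw [e3]
    have hL4 : (0 : ℝ) ≤ 226 * 320 ^ 2 * (L : ℝ) ^ 4 := by positivity
    have h4 : (L : ℝ) ^ 2 * (b / P) + 226 * 320 ^ 2 * (L : ℝ) ^ 4 * (b / P) ^ 2
        ≤ (L : ℝ) ^ 2 * (b / P) + 226 * 320 ^ 2 * (L : ℝ) ^ 4 * (b ^ 2 / P) := by nlinarith
    refine h4.trans ?_
    rw [show (L : ℝ) ^ 2 * (b / P) + 226 * 320 ^ 2 * (L : ℝ) ^ 4 * (b ^ 2 / P)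
        = (L : ℝ) ^ 2 * (b + 226 * 320 ^ 2 * (L : ℝ) ^ 2 * b ^ 2) / P by ring]
    exact div_le_div_of_nonneg_right (mul_le_mul_of_nonneg_left hbq hL2.le) hP0.le
  have hWx : SmallField (cavg L UB) (ε / ((L : ℝ) ^ (j + 1)) ^ 2) := MinimalActionRate.SmallField.mono hsm hrad
  have hadm : cavg L UB ∈ admissible (sfClass 4 L N ε) L (j + 1) V := by
    refine ⟨⟨hWu, hWP, hWx⟩, ?_⟩
    rw [cavg_eq_rescale_bavg, avgIter_rescale_bavg]
    exact hB.mem.2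
  exact ⟨hbε, hs1, hs2, hWu, hWP, hWx, hadm⟩

end

end Summit.QuantumFields.BalabanUV.T4Continuum.NE7EnergyRateWPrepGeneric
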